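import Literature.Analysis.PDE.HeatForwardDuhamel
import Literature.Analysis.PDE.HeatFreeFlowEnergy
import Literature.Analysis.UnboundedOperators.HeatExtensionJointSmooth
import Literature.Analysis.UnboundedOperators.HeatKernelBoundedData
import Literature.Analysis.FunctionSpaces.RegularizedDistance
import HarnessLib

/-!
# The free heat flow on smooth data with bounded square-integrable derivatives
# (topic `Analysis/PDE`)

Analytic layer of the programme to prove short-time existence for quasilinear strictly
parabolic systems on a closed manifold (hypothesis `hQL` of
`Literature.Geometry.Riemannian.ricciFlow_shortTime_existence_of_quasilinear`). The forward
Duhamel integral `𝒱[Θ]` (`HeatForwardDuhamel.lean`) of a space–time test field solves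
`∂ₜV = νΔV + Θ` but, when the data `Θ` are a smooth extension to `t < 0` of data given on
`[0, T]`, has a nonzero value `h = V(0)` at the initial time; the zero initial-value solution is
`V(t) - e^{νtΔ}h`. The initial values `h` arising this way are smooth, with every iterated
directional derivative bounded and square integrable, but not compactly supported. This file
develops the free flow `e^{νtΔ}k` on exactly this class, and the size of such `h`:

* `IsHeatAdmissible k` — `k : E → F'` is `C^∞` and every iterated directional derivative
  `∂_β k` (`FunctionSpaces.iterDirDeriv`) is bounded and in `L²`; closure under directional
  derivatives, sums, scalar multiples, the Laplacian; the slices `𝒱[Θ](t)` of the forward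
  Duhamel integral of a space–time test field are admissible
  (`isHeatAdmissible_heatDuhamelFwd`);
* `freeFlow ν k t x = e^{νtΔ}k(x)` for `t > 0` and `k x` for `t ≤ 0` (the tree's
  `UnboundedOperators.heatExtension` at time `νt`, with the value at `t = 0` built in);
* derivatives fall on the data: `∂ᵥ(freeFlow ν k t) = freeFlow ν (∂ᵥk) t`
  (`fderiv_freeFlow_apply`, `iterDirDeriv_freeFlow`), `Δ(freeFlow ν k t) = freeFlow ν (Δk) t`
  (`laplacian_freeFlow`); the class is invariant (`IsHeatAdmissible.freeFlow`);
* **the heat equation in time INCLUDING the initial time**: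
  `HasDerivWithinAt (freeFlow ν k · x) (ν • freeFlow ν (Δk) t x) (Ici 0) t` for all `t ≥ 0`
  (`hasDerivWithinAt_freeFlow`; at `t = 0` by the limit of the derivative,
  `hasDerivWithinAt_Ici_of_tendsto_deriv`, and the continuity of the caloric extension of
  bounded continuous data at time `0⁺`, `tendsto_heatExtension_nhdsWithin_prod`);
* **the `L²` bounds**: `‖freeFlow ν k t‖₂ ≤ ‖k‖₂` (`eLpNorm_freeFlow_le`, the `L²` contraction)
  and the energy inequality `∫∫_{(0,T) × E} |∇ freeFlow ν k|² ≤ ‖k‖₂²/ν`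
  (`lintegral_prod_frobeniusNormSq_fderiv_freeFlow_le`, from `HeatFreeFlowEnergy.lean` by the
  time scaling `t ↦ νt`);
* **the gradient of a Duhamel integral at a fixed time** (the pointwise-in-time part of
  Lemarié-Rieusset 2016, Prop. 4.3 (C)): `Σᵢ ‖∂ᵢ𝒰[Θ](τ)‖₂² ≤ (2n/ν) ∫_τ^T ‖Θ‖₂²`
  (`IsSpaceTimeTestOn.sum_integral_norm_sq_fderiv_heatDuhamelBack_le`) and its forward form
  `Σᵢ ‖∂ᵢ𝒱[Θ](t)‖₂² ≤ (2n/ν) ∫_{τ₀}^T ‖Θ‖₂²` (`sum_integral_norm_sq_fderiv_heatDuhamelFwd_le`) —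
  the `T`-independent control of `∇h` that keeps the Hessian of the correction `e^{νtΔ}h`
  within maximal regularity.

Everything is proved; no named fact and no `sorry` is introduced.

## References

* L. C. Evans, *Partial Differential Equations*, 2nd ed., AMS 2010, §2.3.1, Thm. 1 (the free
  flow solves the heat equation and attains its initial values). [Evans2010]
* P. G. Lemarié-Rieusset, *The Navier–Stokes problem in the 21st century*, CRC Press 2016,
  Prop. 4.3 (A), (C), p. 74. [LemarieRieusset2016]
-/

noncomputable section

open MeasureTheory Set Function Filter Topology TopologicalSpace Metric InnerProductSpace
open scoped RealInnerProductSpace Laplacian ContDiff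

namespace Literature.Analysis.PDE

open Literature.Analysis.UnboundedOperators Literature.Analysis.FluidPDE
  Literature.Analysis.FunctionSpaces

variable {E : Type*} [NormedAddCommGroup E] [InnerProductSpace ℝ E] [FiniteDimensional ℝ E]
  [MeasurableSpace E] [BorelSpace E]
variable {F' : Type*} [NormedAddCommGroup F'] [InnerProductSpace ℝ F'] [FiniteDimensional ℝ F']

/-! ### The data class -/

/-- **Admissible data for the free heat flow**: `k` is `C^∞` and every iterated directional
derivative `∂_β k` is bounded and square integrable (e.g. Schwartz functions, and the slices of
Duhamel integrals of space–time test fields). [folklore] -/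
structure IsHeatAdmissible (k : E → F') : Prop where
  /-- smoothness -/
  contDiff : ContDiff ℝ ∞ k
  /-- every iterated directional derivative is bounded -/
  bounded : ∀ β : List E, ∃ C : ℝ, ∀ x, ‖iterDirDeriv β k x‖ ≤ C
  /-- every iterated directional derivative is square integrable -/
  memLp : ∀ β : List E, MemLp (iterDirDeriv β k) 2 volume

namespace IsHeatAdmissible

variable {k k₁ k₂ : E → F'}

omit [FiniteDimensional ℝ F'] in
/-- An admissible datum is bounded. [folklore] -/
theorem exists_bound (hk : IsHeatAdmissible k) : ∃ C : ℝ, ∀ x, ‖k x‖ ≤ C := hk.bounded []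

omit [FiniteDimensional ℝ F'] in
/-- An admissible datum is square integrable. [folklore] -/
theorem memLp_two (hk : IsHeatAdmissible k) : MemLp k 2 volume := hk.memLp []

omit [FiniteDimensional ℝ F'] in
/-- **Closure under directional derivatives**: `∂ᵥk` is admissible (`∂_β ∂ᵥ = ∂_{β ++ [v]}`).
[folklore] -/
theorem fderiv_apply (hk : IsHeatAdmissible k) (v : E) :
    IsHeatAdmissible fun x ↦ fderiv ℝ k x v where
  contDiff := (hk.contDiff.fderiv_right (m := ∞) (by norm_cast)).clm_apply contDiff_const
  bounded β := by
    rw [← iterDirDeriv_append_singleton]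
    exact hk.bounded _
  memLp β := by
    rw [← iterDirDeriv_append_singleton]
    exact hk.memLp _

omit [FiniteDimensional ℝ F'] in
/-- Closure under iterated directional derivatives. [folklore] -/
theorem iterDir (hk : IsHeatAdmissible k) : ∀ β : List E, IsHeatAdmissible (iterDirDeriv β k)
  | [] => hk
  | v :: β => (iterDir hk β).fderiv_apply v

omit [FiniteDimensional ℝ F'] in
/-- Closure under sums. [folklore] -/
theorem add (h₁ : IsHeatAdmissible k₁) (h₂ : IsHeatAdmissible k₂) :
    IsHeatAdmissible (k₁ + k₂) where
  contDiff := h₁.contDiff.add h₂.contDiff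
  bounded β := by
    obtain ⟨C₁, hC₁⟩ := h₁.bounded β
    obtain ⟨C₂, hC₂⟩ := h₂.bounded β
    refine ⟨C₁ + C₂, fun x ↦ ?_⟩
    rw [iterDirDeriv_add h₁.contDiff h₂.contDiff, Pi.add_apply]
    exact (norm_add_le _ _).trans (add_le_add (hC₁ x) (hC₂ x))
  memLp β := by
    rw [iterDirDeriv_add h₁.contDiff h₂.contDiff]
    exact (h₁.memLp β).add (h₂.memLp β)

omit [FiniteDimensional ℝ F'] in
/-- Closure under scalar multiples. [folklore] -/
theorem const_smul (hk : IsHeatAdmissible k) (c : ℝ) :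
    IsHeatAdmissible fun x ↦ c • k x where
  contDiff := contDiff_const.smul hk.contDiff
  bounded β := by
    obtain ⟨C, hC⟩ := hk.bounded β
    refine ⟨‖c‖ * C, fun x ↦ ?_⟩
    rw [iterDirDeriv_const_smul hk.contDiff, norm_smul]
    exact mul_le_mul_of_nonneg_left (hC x) (norm_nonneg _)
  memLp β := by
    rw [iterDirDeriv_const_smul hk.contDiff]
    exact (hk.memLp β).const_smul c

omit [FiniteDimensional ℝ E] [MeasurableSpace E] [BorelSpace E] [FiniteDimensional ℝ F'] in
/-- All iterated directional derivatives of the zero map vanish. [folklore] -/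
theorem iterDirDeriv_zero : ∀ β : List E, iterDirDeriv β (fun _ : E ↦ (0 : F')) = fun _ ↦ 0
  | [] => rfl
  | v :: β => by
    funext x
    rw [iterDirDeriv_cons, iterDirDeriv_zero β]
    simp

omit [FiniteDimensional ℝ F'] in
/-- The zero map is admissible. [folklore] -/
theorem zero : IsHeatAdmissible fun _ : E ↦ (0 : F') where
  contDiff := contDiff_const
  bounded β := ⟨0, fun x ↦ by rw [iterDirDeriv_zero β]; simp⟩
  memLp β := by
    rw [iterDirDeriv_zero β]
    exact MemLp.zero' ..

omit [FiniteDimensional ℝ F'] in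
/-- Closure under finite sums. [folklore] -/
theorem sum {ι : Type*} (s : Finset ι) {f : ι → E → F'} (hf : ∀ i ∈ s, IsHeatAdmissible (f i)) :
    IsHeatAdmissible fun x ↦ ∑ i ∈ s, f i x := by
  classical
  induction s using Finset.induction_on with
  | empty => simpa using (zero : IsHeatAdmissible fun _ : E ↦ (0 : F'))
  | insert a s ha ih =>
    have h := (hf a (Finset.mem_insert_self a s)).add
      (ih fun i hi ↦ hf i (Finset.mem_insert_of_mem hi))
    simp only [Finset.sum_insert ha]
    exact h

omit [MeasurableSpace E] [BorelSpace E] [FiniteDimensional ℝ F'] in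
/-- The Laplacian of a `C²` map as a sum of second directional derivatives along the standard
frame. [folklore] -/
theorem laplacian_eq_sum (hk : ContDiff ℝ ∞ k) :
    Δ k = fun x ↦ ∑ i, fderiv ℝ (fun y ↦ fderiv ℝ k y (stdOrthonormalBasis ℝ E i)) x
      (stdOrthonormalBasis ℝ E i) :=
  funext fun x ↦ laplacian_eq_sum_fderiv_fderiv_normed (stdOrthonormalBasis ℝ E)
    (hk.of_le (by norm_cast)) x

omit [FiniteDimensional ℝ F'] in
/-- **Closure under the Laplacian.** [folklore] -/
theorem laplacian (hk : IsHeatAdmissible k) : IsHeatAdmissible (Δ k) := by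
  rw [laplacian_eq_sum hk.contDiff]
  exact sum _ fun i _ ↦ (hk.fderiv_apply _).fderiv_apply _

end IsHeatAdmissible

/-! ### Slices of forward Duhamel integrals are admissible -/

/-- Iterated directional derivatives fall on the data of a forward Duhamel integral:
`∂_β(𝒱[Θ](t)) = 𝒱[∂_βΘ](t)`, and the derived data are again a space–time test field.
[folklore] -/
theorem iterDirDeriv_heatDuhamelFwd {F : Type*} [NormedAddCommGroup F] [NormedSpace ℝ F]
    [CompleteSpace F] {ν : ℝ} (hν : 0 < ν) (t : ℝ) (β : List E) :
    ∀ {Θ : ℝ → E → F}, IsSpaceTimeTestOn (⊤ : Opens (ℝ × E)) Θ →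
      IsSpaceTimeTestOn (⊤ : Opens (ℝ × E)) (fun s ↦ iterDirDeriv β (Θ s)) ∧
        iterDirDeriv β (heatDuhamelFwd ν Θ t) = heatDuhamelFwd ν (fun s ↦ iterDirDeriv β (Θ s)) t := by
  induction β with
  | nil => intro Θ hΘ; exact ⟨hΘ, rfl⟩
  | cons v β ih =>
    intro Θ hΘ
    obtain ⟨h1, h2⟩ := ih hΘ
    refine ⟨h1.fderiv_apply_top v, ?_⟩
    funext x
    rw [iterDirDeriv_cons, h2]
    exact fderiv_heatDuhamelFwd_apply h1 hν t x v

/-- **The slices of the forward Duhamel integral of a space–time test field are admissible**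
(smooth: `contDiff_heatDuhamelFwd`; bounded: `norm_heatDuhamelBack_le`; square integrable:
`memLp_two_heatDuhamelBack`, all applied to the derived data `∂_βΘ`). [folklore] -/
theorem isHeatAdmissible_heatDuhamelFwd {ν : ℝ} (hν : 0 < ν) {Θ : ℝ → E → F'}
    (hΘ : IsSpaceTimeTestOn (⊤ : Opens (ℝ × E)) Θ) (t : ℝ) :
    IsHeatAdmissible (heatDuhamelFwd ν Θ t) := by
  haveI : CompleteSpace F' := FiniteDimensional.complete ℝ F'
  refine ⟨contDiff_heatDuhamelFwd hΘ hν t, fun β ↦ ?_, fun β ↦ ?_⟩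
  · obtain ⟨h1, h2⟩ := iterDirDeriv_heatDuhamelFwd hν t β hΘ
    have hrev := isSpaceTimeTestOn_timeReverse h1
    obtain ⟨M, -, hM⟩ := hrev.exists_norm_le
    obtain ⟨a, b, hab⟩ := hrev.exists_time_support
    refine ⟨M * max (b - -t) 0, fun x ↦ ?_⟩
    rw [h2, heatDuhamelFwd_apply]
    exact hrev.norm_heatDuhamelBack_le hν hM hab (-t) x
  · obtain ⟨h1, h2⟩ := iterDirDeriv_heatDuhamelFwd hν t β hΘ
    rw [h2]
    exact (isSpaceTimeTestOn_timeReverse h1).memLp_two_heatDuhamelBack hν (-t)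

/-! ### The free flow on admissible data -/

/-- **The free heat flow** `e^{νtΔ}k` with its initial value built in: the caloric extension
`heatExtension k (ν t)` for `t > 0` and `k` itself for `t ≤ 0` (Evans, §2.3.1, (8)–(9)).
[cite: Evans2010, §2.3.1, Thm. 1] -/
def freeFlow (ν : ℝ) (k : E → F') (t : ℝ) (x : E) : F' :=
  if 0 < t then heatExtension k (ν * t) x else k x

omit [FiniteDimensional ℝ F'] in
/-- The free flow at positive times. [folklore] -/
theorem freeFlow_of_pos (ν : ℝ) (k : E → F') {t : ℝ} (ht : 0 < t) :
    freeFlow ν k t = heatExtension k (ν * t) := by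
  funext x
  simp [freeFlow, ht]

omit [FiniteDimensional ℝ F'] in
/-- The free flow at nonpositive times is the datum. [folklore] -/
theorem freeFlow_of_nonpos (ν : ℝ) (k : E → F') {t : ℝ} (ht : t ≤ 0) : freeFlow ν k t = k := by
  funext x
  simp [freeFlow, not_lt.2 ht]

omit [FiniteDimensional ℝ F'] in
/-- The free flow at time `0` is the datum. [folklore] -/
@[simp]
theorem freeFlow_zero (ν : ℝ) (k : E → F') : freeFlow ν k 0 = k := freeFlow_of_nonpos ν k le_rfl

variable {ν : ℝ} {k : E → F'}

/-- **Directional derivatives fall on the data**: `∂ᵥ(e^{νtΔ}k) = e^{νtΔ}(∂ᵥk)` for admissible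
`k` and `t ≥ 0` (`fderiv_heatExtension_apply_of_bounded`). [folklore] -/
theorem fderiv_freeFlow_apply (hk : IsHeatAdmissible k) (hν : 0 < ν) (t : ℝ) (x v : E) :
    fderiv ℝ (freeFlow ν k t) x v = freeFlow ν (fun y ↦ fderiv ℝ k y v) t x := by
  haveI : CompleteSpace F' := FiniteDimensional.complete ℝ F'
  rcases le_or_gt t 0 with ht | ht
  · rw [freeFlow_of_nonpos ν k ht, freeFlow_of_nonpos ν _ ht]
  · rw [freeFlow_of_pos ν k ht, freeFlow_of_pos ν _ ht]
    obtain ⟨C₀, hC₀⟩ := hk.exists_bound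
    obtain ⟨C₁, hC₁⟩ := hk.bounded [v]
    exact fderiv_heatExtension_apply_of_bounded (hk.contDiff.of_le (by norm_cast)) hC₀
      (fun z ↦ by simpa [iterDirDeriv] using hC₁ z) (mul_pos hν ht) x

/-- Iterated directional derivatives fall on the data of the free flow. [folklore] -/
theorem iterDirDeriv_freeFlow (hν : 0 < ν) (t : ℝ) (β : List E) :
    ∀ {k : E → F'}, IsHeatAdmissible k →
      iterDirDeriv β (freeFlow ν k t) = freeFlow ν (iterDirDeriv β k) t := by
  induction β with
  | nil => intro k _; rfl
  | cons v β ih =>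
    intro k hk
    funext x
    rw [iterDirDeriv_cons, ih hk, iterDirDeriv_cons]
    exact fderiv_freeFlow_apply (hk.iterDir β) hν t x v


/-! ### Operator-norm bounds from directional bounds -/

omit [MeasurableSpace E] [BorelSpace E] [InnerProductSpace ℝ F'] [FiniteDimensional ℝ F'] in
/-- The operator norm of a linear map is at most the sum of the norms of its values on an
orthonormal basis. [folklore] -/
theorem opNorm_le_sum_norm_apply_stdOrthonormalBasis {G : Type*} [NormedAddCommGroup G]
    [NormedSpace ℝ G] (L : E →L[ℝ] G) :
    ‖L‖ ≤ ∑ i, ‖L (stdOrthonormalBasis ℝ E i)‖ := by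
  set b := stdOrthonormalBasis ℝ E
  refine ContinuousLinearMap.opNorm_le_bound _ (Finset.sum_nonneg fun i _ ↦ norm_nonneg _)
    fun v ↦ ?_
  have hv : L v = ∑ i, ⟪b i, v⟫ • L (b i) := by
    conv_lhs => rw [← b.sum_repr' v]
    simp [map_sum, map_smul]
  rw [hv, Finset.sum_mul]
  refine (norm_sum_le _ _).trans (Finset.sum_le_sum fun i _ ↦ ?_)
  rw [norm_smul, mul_comm]
  refine mul_le_mul_of_nonneg_left ?_ (norm_nonneg _)
  have h := abs_real_inner_le_norm (b i) v
  rw [b.orthonormal.1 i, one_mul] at h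
  exact h

namespace IsHeatAdmissible

variable {k : E → F'}

omit [FiniteDimensional ℝ F'] in
/-- An admissible datum has bounded derivative (operator norm). [folklore] -/
theorem exists_bound_fderiv (hk : IsHeatAdmissible k) : ∃ C : ℝ, ∀ x, ‖fderiv ℝ k x‖ ≤ C := by
  classical
  choose C hC using fun i ↦ hk.bounded [stdOrthonormalBasis ℝ E i]
  refine ⟨∑ i, C i, fun x ↦ (opNorm_le_sum_norm_apply_stdOrthonormalBasis _).trans
    (Finset.sum_le_sum fun i _ ↦ ?_)⟩
  simpa [FunctionSpaces.iterDirDeriv] using hC i x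

omit [FiniteDimensional ℝ F'] in
/-- An admissible datum has bounded second derivative (operator norm). [folklore] -/
theorem exists_bound_fderiv_fderiv (hk : IsHeatAdmissible k) :
    ∃ C : ℝ, ∀ x, ‖fderiv ℝ (fderiv ℝ k) x‖ ≤ C := by
  classical
  set b := stdOrthonormalBasis ℝ E
  choose C hC using fun p : _ × _ ↦ hk.bounded [b p.1, b p.2]
  refine ⟨∑ i, ∑ j, C (i, j), fun x ↦ ?_⟩
  refine (opNorm_le_sum_norm_apply_stdOrthonormalBasis _).trans (Finset.sum_le_sum fun i _ ↦ ?_)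
  refine (opNorm_le_sum_norm_apply_stdOrthonormalBasis _).trans (Finset.sum_le_sum fun j _ ↦ ?_)
  have hd : DifferentiableAt ℝ (fderiv ℝ k) x :=
    ((hk.contDiff.fderiv_right (m := 1) (by norm_cast)).differentiable one_ne_zero) x
  have h1 : fderiv ℝ (fderiv ℝ k) x (b i) (b j) = fderiv ℝ (fun y ↦ fderiv ℝ k y (b j)) x (b i) := by
    rw [fderiv_clm_apply hd (differentiableAt_const _)]
    simp
  rw [h1]
  simpa [FunctionSpaces.iterDirDeriv] using hC (i, j) x

end IsHeatAdmissible

/-! ### The heat equation for the free flow, including the initial time -/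

/-- The Laplacian falls on the data of the free flow. [folklore] -/
theorem laplacian_freeFlow (hk : IsHeatAdmissible k) (hν : 0 < ν) (t : ℝ) (x : E) :
    (Δ (freeFlow ν k t)) x = freeFlow ν (Δ k) t x := by
  haveI : CompleteSpace F' := FiniteDimensional.complete ℝ F'
  rcases le_or_gt t 0 with ht | ht
  · rw [freeFlow_of_nonpos ν k ht, freeFlow_of_nonpos ν _ ht]
  · rw [freeFlow_of_pos ν k ht, freeFlow_of_pos ν _ ht]
    obtain ⟨C₀, hC₀⟩ := hk.exists_bound
    obtain ⟨C₁, hC₁⟩ := hk.exists_bound_fderiv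
    obtain ⟨C₂, hC₂⟩ := hk.exists_bound_fderiv_fderiv
    exact laplacian_heatExtension_of_bounded (hk.contDiff.of_le (by norm_cast)) hC₀ hC₁ hC₂
      (mul_pos hν ht) x

/-- **The heat equation at positive times**: `∂ₜ(e^{νtΔ}k)(x) = ν e^{νtΔ}(Δk)(x)`, `t > 0`.
[cite: Evans2010, §2.3.1, Thm. 1] -/
theorem hasDerivAt_freeFlow_of_pos (hk : IsHeatAdmissible k) (hν : 0 < ν) {t : ℝ} (ht : 0 < t)
    (x : E) :
    HasDerivAt (fun s ↦ freeFlow ν k s x) (ν • freeFlow ν (Δ k) t x) t := by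
  haveI : CompleteSpace F' := FiniteDimensional.complete ℝ F'
  obtain ⟨C₀, hC₀⟩ := hk.exists_bound
  obtain ⟨C₁, hC₁⟩ := hk.exists_bound_fderiv
  obtain ⟨C₂, hC₂⟩ := hk.exists_bound_fderiv_fderiv
  have h := hasDerivAt_heatExtension_time_of_bounded (hk.contDiff.of_le (by norm_cast)) hC₀ hC₁ hC₂
    (mul_pos hν ht) x
  -- chain rule along `s ↦ ν s`
  have hc : HasDerivAt (fun s : ℝ ↦ ν * s) ν t := by
    simpa using (hasDerivAt_id t).const_mul ν
  have h2 := h.scomp t hc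
  rw [freeFlow_of_pos ν _ ht]
  refine h2.congr_of_eventuallyEq ?_
  filter_upwards [Ioi_mem_nhds ht] with s hs
  simp only [Function.comp_apply]
  rw [freeFlow_of_pos ν k hs]

/-- Continuity of the caloric extension of bounded continuous data at time `0⁺` along
`s ↦ (ν s, x)`. [folklore] -/
theorem tendsto_heatExtension_mul_nhdsGT {g : E → F'}
    (hg : Continuous g) {C : ℝ} (hC : ∀ z, ‖g z‖ ≤ C) (hν : 0 < ν) (x : E) :
    Tendsto (fun s : ℝ ↦ heatExtension g (ν * s) x) (𝓝[>] 0) (𝓝 (g x)) := by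
  haveI : CompleteSpace F' := FiniteDimensional.complete ℝ F'
  have h := tendsto_heatExtension_nhdsWithin_prod hg hC x
  have hφ : Tendsto (fun s : ℝ ↦ ((ν * s, x) : ℝ × E)) (𝓝[>] 0) (𝓝[Ioi 0 ×ˢ univ] ((0 : ℝ), x)) := by
    refine tendsto_nhdsWithin_iff.2 ⟨?_, ?_⟩
    · have hc : Continuous fun s : ℝ ↦ ((ν * s, x) : ℝ × E) := by fun_prop
      have h1 := hc.tendsto 0
      simp only [mul_zero] at h1
      exact h1.mono_left nhdsWithin_le_nhds
    · filter_upwards [self_mem_nhdsWithin] with s hs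
      exact ⟨mul_pos hν hs, mem_univ _⟩
  -- (stated through `congr` to avoid a higher-order unification of the composite)
  have h3 := h.comp hφ
  refine h3.congr fun s ↦ ?_
  simp only [Function.comp_apply]

/-- **The heat equation at the initial time** (one-sided): for admissible `k`,
`s ↦ e^{νsΔ}k(x)` has right derivative `ν Δk(x)` at `s = 0` within `[0, ∞)` — the limit of the
derivative `ν e^{νsΔ}(Δk)(x) → ν Δk(x)` and the continuity `e^{νsΔ}k(x) → k(x)` as `s → 0⁺`
(Evans, §2.3.1, Thm. 1 (iii) for the derived data). [cite: Evans2010, §2.3.1, Thm. 1] -/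
theorem hasDerivWithinAt_freeFlow_zero (hk : IsHeatAdmissible k) (hν : 0 < ν) (x : E) :
    HasDerivWithinAt (fun s ↦ freeFlow ν k s x) (ν • (Δ k) x) (Ici 0) 0 := by
  haveI : CompleteSpace F' := FiniteDimensional.complete ℝ F'
  have hΔ := hk.laplacian
  obtain ⟨C₀, hC₀⟩ := hk.exists_bound
  obtain ⟨D₀, hD₀⟩ := hΔ.exists_bound
  refine hasDerivWithinAt_Ici_of_tendsto_deriv (s := Ioi 0) ?_ ?_ self_mem_nhdsWithin ?_
  · exact fun s hs ↦ (hasDerivAt_freeFlow_of_pos hk hν hs x).differentiableAt.differentiableWithinAt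
  · -- continuity at `0⁺`
    have h := tendsto_heatExtension_mul_nhdsGT hk.contDiff.continuous hC₀ hν x
    rw [ContinuousWithinAt, freeFlow_zero]
    refine h.congr' ?_
    filter_upwards [self_mem_nhdsWithin] with s hs
    rw [freeFlow_of_pos ν k hs]
  · have h := tendsto_heatExtension_mul_nhdsGT hΔ.contDiff.continuous hD₀ hν x
    refine ((h.const_smul ν).congr' ?_)
    filter_upwards [self_mem_nhdsWithin] with s hs
    rw [(hasDerivAt_freeFlow_of_pos hk hν hs x).deriv, freeFlow_of_pos ν _ hs]

/-- **The free flow solves the heat equation on `[0, ∞)`** (one-sided at `t = 0`):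
`HasDerivWithinAt (e^{ν·Δ}k(x)) (ν e^{νtΔ}(Δk)(x)) [0, ∞) t` for `t ≥ 0` and admissible `k`.
[cite: Evans2010, §2.3.1, Thm. 1] -/
theorem hasDerivWithinAt_freeFlow (hk : IsHeatAdmissible k) (hν : 0 < ν) {t : ℝ} (ht : 0 ≤ t)
    (x : E) :
    HasDerivWithinAt (fun s ↦ freeFlow ν k s x) (ν • freeFlow ν (Δ k) t x) (Ici 0) t := by
  rcases ht.eq_or_lt with rfl | ht'
  · rw [freeFlow_zero]
    exact hasDerivWithinAt_freeFlow_zero hk hν x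
  · exact (hasDerivAt_freeFlow_of_pos hk hν ht' x).hasDerivWithinAt

/-! ### The `L²` bounds of the free flow -/

/-- **`L²` contraction**: `‖e^{νtΔ}k‖₂ ≤ ‖k‖₂` for all `t` (the tree's
`eLpNorm_heatExtension_le_holds` for `t > 0`). [cite: LemarieRieusset2016, Prop. 4.3 (A)] -/
theorem eLpNorm_freeFlow_le (hk : IsHeatAdmissible k) (hν : 0 < ν) (t : ℝ) :
    eLpNorm (freeFlow ν k t) 2 volume ≤ eLpNorm k 2 volume := by
  haveI : CompleteSpace F' := FiniteDimensional.complete ℝ F'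
  rcases le_or_gt t 0 with ht | ht
  · rw [freeFlow_of_nonpos ν k ht]
  · rw [freeFlow_of_pos ν k ht]
    exact eLpNorm_heatExtension_le_holds hk.memLp_two one_le_two (mul_pos hν ht)

/-- The free flow of an admissible datum is admissible. [folklore] -/
theorem IsHeatAdmissible.freeFlow (hk : IsHeatAdmissible k) (hν : 0 < ν) (t : ℝ) :
    IsHeatAdmissible (freeFlow ν k t) := by
  haveI : CompleteSpace F' := FiniteDimensional.complete ℝ F'
  rcases le_or_gt t 0 with ht | ht
  · rw [freeFlow_of_nonpos ν k ht]; exact hk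
  · refine ⟨?_, fun β ↦ ?_, fun β ↦ ?_⟩
    · rw [freeFlow_of_pos ν k ht]
      obtain ⟨C₀, hC₀⟩ := hk.exists_bound
      exact contDiff_heatExtension_of_bound hk.contDiff.continuous hC₀ (mul_pos hν ht)
    · rw [iterDirDeriv_freeFlow hν t β hk, freeFlow_of_pos ν _ ht]
      obtain ⟨C, hC⟩ := (hk.iterDir β).exists_bound
      have hC0 : 0 ≤ C := (norm_nonneg _).trans (hC 0)
      exact ⟨C, fun x ↦ norm_heatExtension_le hC (mul_pos hν ht) x⟩
    · rw [iterDirDeriv_freeFlow hν t β hk]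
      have h1 := eLpNorm_freeFlow_le (hk.iterDir β) hν t
      have hβ := hk.iterDir β
      refine ⟨?_, lt_of_le_of_lt h1 hβ.memLp_two.eLpNorm_lt_top⟩
      rw [freeFlow_of_pos ν _ ht]
      obtain ⟨C, hC⟩ := hβ.exists_bound
      exact (contDiff_heatExtension_of_bound hβ.contDiff.continuous hC (mul_pos hν ht)
        (m := 0)).continuous.aestronglyMeasurable

/-- **The energy inequality of the free flow with diffusivity `ν`**:
`∫∫_{(0,T) × E} |∇ e^{ντΔ} k|² dx dτ ≤ ‖k‖₂² / ν` (time scaling `τ ↦ ντ` in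
`lintegral_prod_frobeniusNormSq_fderiv_heatExtension_le`). [cite: LemarieRieusset2016, Prop. 4.3 (A)] -/
theorem lintegral_prod_frobeniusNormSq_fderiv_freeFlow_le (hk : IsHeatAdmissible k) (hν : 0 < ν)
    (T : ℝ) :
    ∫⁻ z in Ioo 0 T ×ˢ (univ : Set E),
        ENNReal.ofReal (frobeniusNormSq (fderiv ℝ (freeFlow ν k z.1) z.2)) ≤
      ENNReal.ofReal ν⁻¹ * eLpNorm k 2 volume ^ 2 := by
  -- the scaling `Φ (τ, x) = (ν τ, x)` as a measurable equivalence
  set Φ : ℝ × E ≃ᵐ ℝ × E := (MeasurableEquiv.mulLeft₀ ν hν.ne').prodCongr (MeasurableEquiv.refl E)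
    with hΦ
  have hΦapply : ∀ z : ℝ × E, Φ z = (ν * z.1, z.2) := fun z ↦ rfl
  have hmap : Measure.map Φ (volume : Measure (ℝ × E)) = ENNReal.ofReal |ν⁻¹| • volume := by
    rw [Measure.volume_eq_prod, show (Φ : ℝ × E → ℝ × E) = Prod.map (fun τ : ℝ ↦ ν * τ) id from
      funext fun z ↦ rfl, ← Measure.map_prod_map _ _ (measurable_const_mul ν) measurable_id,
      Real.map_volume_mul_left hν.ne', Measure.map_id, Measure.prod_smul_left]
  set G : ℝ × E → ENNReal := fun z ↦
    ENNReal.ofReal (frobeniusNormSq (fderiv ℝ (heatExtension k z.1) z.2)) with hG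
  -- the integrand on `(0,T) × E` is `G ∘ Φ`
  have hcongr : ∫⁻ z in Ioo 0 T ×ˢ (univ : Set E),
      ENNReal.ofReal (frobeniusNormSq (fderiv ℝ (freeFlow ν k z.1) z.2)) =
        ∫⁻ z in Ioo 0 T ×ˢ (univ : Set E), G (Φ z) := by
    refine setLIntegral_congr_fun (measurableSet_Ioo.prod MeasurableSet.univ) fun z hz ↦ ?_
    rw [hG, hΦapply, freeFlow_of_pos ν k (mem_prod.1 hz).1.1]
  rw [hcongr]
  have hpre : Φ ⁻¹' (Ioo 0 (ν * T) ×ˢ (univ : Set E)) = Ioo 0 T ×ˢ univ := by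
    ext z
    simp only [mem_preimage, hΦapply, mem_prod, mem_Ioo, mem_univ, and_true]
    constructor
    · rintro ⟨h1, h2⟩
      exact ⟨(mul_pos_iff_of_pos_left hν).1 h1, lt_of_mul_lt_mul_left h2 hν.le⟩
    · rintro ⟨h1, h2⟩
      exact ⟨mul_pos hν h1, mul_lt_mul_of_pos_left h2 hν⟩
  have key : ∫⁻ z in Ioo 0 T ×ˢ (univ : Set E), G (Φ z) =
      ENNReal.ofReal |ν⁻¹| * ∫⁻ z in Ioo 0 (ν * T) ×ˢ (univ : Set E), G z := by
    rw [← hpre, ← Φ.measurableEmbedding.lintegral_map, ← Φ.measurableEmbedding.restrict_map, hmap,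
      Measure.restrict_smul, lintegral_smul_measure, smul_eq_mul]
  rw [key, abs_of_pos (inv_pos.2 hν)]
  gcongr
  exact lintegral_prod_frobeniusNormSq_fderiv_heatExtension_le hk.memLp_two _


/-! ### The gradient of a Duhamel integral at a fixed time -/

section GradientSup

variable {F : Type*} [NormedAddCommGroup F] [InnerProductSpace ℝ F] [CompleteSpace F]
  {Θ : ℝ → E → F}

/-- **Pointwise-in-time gradient bound for the backward Duhamel integral** (the sup part of
Lemarié-Rieusset 2016, Prop. 4.3 (C)): with the data of `energy_estimate_one`,
`Σᵢ ‖∂ᵢ𝒰[Θ](τ)‖₂² ≤ (2n/ν) ∫_{τ}^T ‖Θ(s)‖₂² ds` for `τ ≤ T`, `b ≤ T` — from the second energy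
identity (`energy_identity_one`: the left side plus `2νX` is `-2∫⟨ΔU, Θ⟩`), Cauchy–Schwarz on
the slab, `‖ΔU‖² ≤ n Σᵢⱼ‖∂ⱼ∂ᵢU‖²` and the maximal regularity `X ≤ nQ/ν²`.
[cite: LemarieRieusset2016, Prop. 4.3 (C)] -/
theorem _root_.Literature.Analysis.FluidPDE.IsSpaceTimeTestOn.sum_integral_norm_sq_fderiv_heatDuhamelBack_le
    (hΘ : IsSpaceTimeTestOn (⊤ : Opens (ℝ × E)) Θ) (hν : 0 < ν) {a b : ℝ}
    (hab : ∀ t, t ∉ Icc a b → Θ t = 0) {τ T : ℝ} (hτT : τ ≤ T) (hbT : b ≤ T) :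
    ∑ i, ∫ x, ‖fderiv ℝ (heatDuhamelBack ν Θ τ) x (stdOrthonormalBasis ℝ E i)‖ ^ 2 ≤
      2 * (Module.finrank ℝ E : ℝ) / ν * ∫ s in τ..T, ∫ x, ‖Θ s x‖ ^ 2 := by
  set bE := stdOrthonormalBasis ℝ E
  set n : ℝ := (Module.finrank ℝ E : ℝ) with hn
  set μ : Measure (E × ℝ) := (volume : Measure E).prod (volume.restrict (Ioc τ T)) with hμ
  set Q : ℝ := ∫ s in τ..T, ∫ x, ‖Θ s x‖ ^ 2 with hQ
  have hQ' : ∫ q, ‖Θ q.2 q.1‖ ^ 2 ∂μ = Q := hΘ.integral_prod_sq_norm_eq hτT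
  have hQ0 : 0 ≤ Q := by
    rw [← hQ']
    exact integral_nonneg fun _ ↦ by positivity
  have hΘl : IsSpaceTimeTestOn (⊤ : Opens (ℝ × E)) (fun t ↦ Δ (Θ t)) := hΘ.laplacian_top
  have hΘi : ∀ i, IsSpaceTimeTestOn (⊤ : Opens (ℝ × E)) (fun t y ↦ fderiv ℝ (Θ t) y (bE i)) :=
    fun i ↦ hΘ.fderiv_apply_top (bE i)
  have hΔ : ∀ s x, (Δ (heatDuhamelBack ν Θ s)) x = heatDuhamelBack ν (fun t ↦ Δ (Θ t)) s x :=
    fun s x ↦ hΘ.laplacian_heatDuhamelBack hν s x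
  -- `X` and the maximal regularity bound
  set X : ℝ := ∫ s in τ..T, ∑ i, ∑ j, ∫ x,
    ‖fderiv ℝ (fun y ↦ fderiv ℝ (heatDuhamelBack ν Θ s) y (bE i)) x (bE j)‖ ^ 2 with hX
  have hXle : X ≤ n / ν ^ 2 * Q := hΘ.energy_estimate_one hν hab hτT hbT
  have hUi : ∀ i s, heatDuhamelBack ν (fun t y ↦ fderiv ℝ (Θ t) y (bE i)) s =
      fun x ↦ fderiv ℝ (heatDuhamelBack ν Θ s) x (bE i) := fun i s ↦
    funext fun x ↦ (hΘ.fderiv_heatDuhamelBack_apply hν s x (bE i)).symm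
  have hUij : ∀ i j s x, fderiv ℝ (fun y ↦ fderiv ℝ (heatDuhamelBack ν Θ s) y (bE i)) x (bE j) =
      heatDuhamelBack ν (fun t y ↦ fderiv ℝ (fun z ↦ fderiv ℝ (Θ t) z (bE i)) y (bE j)) s x :=
    fun i j s x ↦ by
    rw [← hUi i s]
    exact (hΘi i).fderiv_heatDuhamelBack_apply hν s x (bE j)
  have iij : ∀ i j s, Integrable (fun x ↦
      ‖fderiv ℝ (fun y ↦ fderiv ℝ (heatDuhamelBack ν Θ s) y (bE i)) x (bE j)‖ ^ 2) volume :=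
    fun i j s ↦ by
    have hm := ((hΘi i).fderiv_apply_top (bE j)).memLp_two_heatDuhamelBack hν s
    have h := (memLp_two_iff_integrable_sq_norm hm.1).1 hm
    refine h.congr (Eventually.of_forall fun x ↦ ?_)
    simp only [hUij]
  have ie₂ : IntegrableOn (fun s ↦ ∑ i, ∑ j, ∫ x,
      ‖fderiv ℝ (fun y ↦ fderiv ℝ (heatDuhamelBack ν Θ s) y (bE i)) x (bE j)‖ ^ 2)
      (Ioc τ T) volume := by
    refine integrable_finsetSum _ fun i _ ↦ integrable_finsetSum _ fun j _ ↦ ?_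
    have hΘij := (hΘi i).fderiv_apply_top (bE j)
    have h := (hΘij.integrable_prod_sq_norm_heatDuhamelBack hν τ T).integral_prod_right
    refine h.congr (Eventually.of_forall fun s ↦ integral_congr_ae (Eventually.of_forall fun x ↦ ?_))
    simp only [hUij]
  have hX0 : 0 ≤ X :=
    intervalIntegral.integral_nonneg hτT fun s _ ↦ Finset.sum_nonneg fun i _ ↦
      Finset.sum_nonneg fun j _ ↦ integral_nonneg fun _ ↦ by positivity
  -- the pairing `J = ∫∫ |⟪ΔU, Θ⟫|`
  have hjoint := hΘl.integrable_prod_inner_heatDuhamelBack_test hΘ hν τ T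
  set J : ℝ := ∫ q, |⟪heatDuhamelBack ν (fun t ↦ Δ (Θ t)) q.2 q.1, Θ q.2 q.1⟫| ∂μ with hJ
  -- (i) `G ≤ 2J` from the second energy identity (dropping `2νX ≥ 0`)
  set G : ℝ := ∑ i, ∫ x, ‖fderiv ℝ (heatDuhamelBack ν Θ τ) x (bE i)‖ ^ 2 with hG
  have hG2J : G ≤ 2 * J := by
    have hE := hΘ.energy_identity_one hν hab hτT hbT
    have hP : -(∫ s in τ..T, ∫ x, ⟪(Δ (heatDuhamelBack ν Θ s)) x, Θ s x⟫) ≤ J := by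
      have ipabs : IntervalIntegrable (fun s ↦ ∫ x,
          |⟪heatDuhamelBack ν (fun t ↦ Δ (Θ t)) s x, Θ s x⟫|) volume τ T := by
        rw [intervalIntegrable_iff_integrableOn_Ioc_of_le hτT]
        exact hjoint.abs.integral_prod_right
      have ip : IntervalIntegrable (fun s ↦ ∫ x,
          ⟪heatDuhamelBack ν (fun t ↦ Δ (Θ t)) s x, Θ s x⟫) volume τ T := by
        rw [intervalIntegrable_iff_integrableOn_Ioc_of_le hτT]
        exact hjoint.integral_prod_right
      simp_rw [hΔ]
      rw [← intervalIntegral.integral_neg]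
      calc ∫ s in τ..T, -∫ x, ⟪heatDuhamelBack ν (fun t ↦ Δ (Θ t)) s x, Θ s x⟫
          ≤ ∫ s in τ..T, ∫ x, |⟪heatDuhamelBack ν (fun t ↦ Δ (Θ t)) s x, Θ s x⟫| :=
            intervalIntegral.integral_mono_on hτT ip.neg ipabs fun s _ ↦
              (neg_le_abs _).trans abs_integral_le_integral_abs
        _ = J := by rw [hJ, integral_prod_symm _ hjoint.abs, intervalIntegral.integral_of_le hτT]
    have hνX : 0 ≤ 2 * ν * X := by positivity
    have hE' : G + 2 * ν * X = -2 * ∫ s in τ..T, ∫ x, ⟪(Δ (heatDuhamelBack ν Θ s)) x, Θ s x⟫ := hE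
    linarith
  -- (ii) Cauchy–Schwarz and `‖ΔU‖²_{L²(slab)} ≤ n X`
  have hCS : J ≤ (∫ q, ‖heatDuhamelBack ν (fun t ↦ Δ (Θ t)) q.2 q.1‖ ^ 2 ∂μ) ^ (1 / 2 : ℝ) *
      Q ^ (1 / 2 : ℝ) := by
    rw [← hQ']
    exact integral_abs_inner_le_sqrt_mul_sqrt (hΘl.memLp_two_prod_heatDuhamelBack hν τ T)
      (hΘ.memLp_two_prod τ T)
  have hΔΔ : ∫ q, ‖heatDuhamelBack ν (fun t ↦ Δ (Θ t)) q.2 q.1‖ ^ 2 ∂μ ≤ n * X := by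
    rw [hμ, integral_prod_symm _ (hΘl.integrable_prod_sq_norm_heatDuhamelBack hν τ T), hX,
      intervalIntegral.integral_of_le hτT, ← integral_const_mul]
    have hi : IntegrableOn (fun s ↦ ∫ x, ‖heatDuhamelBack ν (fun t ↦ Δ (Θ t)) s x‖ ^ 2)
        (Ioc τ T) volume :=
      (hΘl.integrable_prod_sq_norm_heatDuhamelBack hν τ T).integral_prod_right
    refine setIntegral_mono_on hi (ie₂.const_mul n) measurableSet_Ioc fun s _ ↦ ?_
    dsimp only
    have isum : Integrable (fun x ↦ ∑ i, ∑ j,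
        ‖fderiv ℝ (fun y ↦ fderiv ℝ (heatDuhamelBack ν Θ s) y (bE i)) x (bE j)‖ ^ 2) volume :=
      integrable_finsetSum _ fun i _ ↦ integrable_finsetSum _ fun j _ ↦ iij i j s
    have hrhs : ∫ x, n * ∑ i, ∑ j,
        ‖fderiv ℝ (fun y ↦ fderiv ℝ (heatDuhamelBack ν Θ s) y (bE i)) x (bE j)‖ ^ 2 =
        n * ∑ i, ∑ j, ∫ x,
          ‖fderiv ℝ (fun y ↦ fderiv ℝ (heatDuhamelBack ν Θ s) y (bE i)) x (bE j)‖ ^ 2 := by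
      rw [integral_const_mul, integral_finsetSum _ fun i _ ↦
        integrable_finsetSum _ fun j _ ↦ iij i j s]
      congr 1
      exact Finset.sum_congr rfl fun i _ ↦ integral_finsetSum _ fun j _ ↦ iij i j s
    rw [← hrhs]
    refine integral_mono_of_nonneg (Eventually.of_forall fun _ ↦ by positivity) (isum.const_mul n)
      (Eventually.of_forall fun x ↦ ?_)
    dsimp only
    rw [← hΔ s x]
    exact norm_laplacian_sq_le (hΘ.contDiff_two_heatDuhamelBack hν s) x
  -- (iii) algebra
  have hJle : J ≤ Real.sqrt (n * X) * Real.sqrt Q := by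
    have h := hCS.trans (mul_le_mul_of_nonneg_right (Real.rpow_le_rpow
      (integral_nonneg fun _ ↦ by positivity) hΔΔ (by norm_num)) (Real.rpow_nonneg hQ0 _))
    rw [← Real.sqrt_eq_rpow, ← Real.sqrt_eq_rpow] at h
    exact h
  have hnX : n * X ≤ (n / ν) ^ 2 * Q := by
    have hn0 : 0 ≤ n := by positivity
    calc n * X ≤ n * (n / ν ^ 2 * Q) := mul_le_mul_of_nonneg_left hXle hn0
      _ = (n / ν) ^ 2 * Q := by field_simp
  have hsqrt : Real.sqrt (n * X) * Real.sqrt Q ≤ n / ν * Q := by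
    have h1 : Real.sqrt (n * X) ≤ n / ν * Real.sqrt Q := by
      calc Real.sqrt (n * X) ≤ Real.sqrt ((n / ν) ^ 2 * Q) := Real.sqrt_le_sqrt hnX
        _ = n / ν * Real.sqrt Q := by
          rw [Real.sqrt_mul (sq_nonneg _), Real.sqrt_sq (by positivity)]
    calc Real.sqrt (n * X) * Real.sqrt Q ≤ n / ν * Real.sqrt Q * Real.sqrt Q :=
          mul_le_mul_of_nonneg_right h1 (Real.sqrt_nonneg _)
      _ = n / ν * Q := by rw [mul_assoc, Real.mul_self_sqrt hQ0]
  calc G ≤ 2 * J := hG2J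
    _ ≤ 2 * (n / ν * Q) := by linarith
    _ = 2 * n / ν * Q := by ring

/-- **Pointwise-in-time gradient bound for the forward Duhamel integral**: for a space–time
test field `Θ` vanishing for `s < τ₀` and `τ₀ ≤ t ≤ T`,
`Σᵢ ‖∂ᵢ𝒱[Θ](t)‖₂² ≤ (2n/ν) ∫_{τ₀}^T ‖Θ(s)‖₂² ds`. [cite: LemarieRieusset2016, Prop. 4.3 (C)] -/
theorem sum_integral_norm_sq_fderiv_heatDuhamelFwd_le
    (hΘ : IsSpaceTimeTestOn (⊤ : Opens (ℝ × E)) Θ) (hν : 0 < ν) {τ₀ b : ℝ}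
    (hab : ∀ t, t ∉ Icc τ₀ b → Θ t = 0) {t T : ℝ} (hτ₀t : τ₀ ≤ t) (htT : t ≤ T) :
    ∑ i, ∫ x, ‖fderiv ℝ (heatDuhamelFwd ν Θ t) x (stdOrthonormalBasis ℝ E i)‖ ^ 2 ≤
      2 * (Module.finrank ℝ E : ℝ) / ν * ∫ s in τ₀..T, ∫ x, ‖Θ s x‖ ^ 2 := by
  have hrev := isSpaceTimeTestOn_timeReverse hΘ
  have habr : ∀ s, s ∉ Icc (-b) (-τ₀) → timeReverse Θ s = 0 := timeReverse_eq_zero_of_notMem hab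
  have h := hrev.sum_integral_norm_sq_fderiv_heatDuhamelBack_le hν habr (τ := -t) (T := -τ₀)
    (by linarith) le_rfl
  -- `∫_{-t}^{-τ₀} ‖Θ̌‖² = ∫_{τ₀}^{t} ‖Θ‖² ≤ ∫_{τ₀}^{T} ‖Θ‖²`
  rw [intervalIntegral_timeReverse_sq_norm] at h
  have hmono : ∫ s in τ₀..t, ∫ x, ‖Θ s x‖ ^ 2 ≤ ∫ s in τ₀..T, ∫ x, ‖Θ s x‖ ^ 2 := by
    rw [intervalIntegral.integral_of_le hτ₀t, intervalIntegral.integral_of_le (hτ₀t.trans htT)]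
    have hi : IntegrableOn (fun s ↦ ∫ x, ‖Θ s x‖ ^ 2) (Ioc τ₀ T) volume :=
      (hΘ.integrable_prod_sq_norm τ₀ T).integral_prod_right
    exact setIntegral_mono_set hi (Eventually.of_forall fun s ↦ integral_nonneg fun _ ↦ by positivity)
      (Eventually.of_forall (Ioc_subset_Ioc_right htT))
  have hn : 0 ≤ 2 * (Module.finrank ℝ E : ℝ) / ν := by positivity
  exact h.trans (mul_le_mul_of_nonneg_left hmono hn)

end GradientSup

end Literature.Analysis.PDE

end
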